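import Mathlib
import HarnessLib
import Literature.Probability.Process.PointStationaryLaw
import Literature.MathematicalPhysics.StatisticalMechanics.RootEnergy
import Literature.MathematicalPhysics.StatisticalMechanics.LennardJonesClusters
import Summits.AtomisticToContinuum.Crystallization.Theorems.ChargedEnergyGap.Negative.Unconditional

/-!
# FrustratedLawDichotomy · `AperiodicFrustratedLawGap` (stmt-AtomisticToContinuum-27623) · finite-cluster case of the registered stub
# `stub_aperiodicErgodicGap` — PRELUDE: strict periodisation, re-rooted hard-core configurations, the truncated identity kernel

Support file (decomp-a2c, prover hand 2, structural share of the crux `AperiodicFrustratedLawGap`).  Three independent tools: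
* **Strict periodisation** (`card_mul_eStar_lt_interactionEnergy`): `N·e⋆ < E_LJ(x)` for every injective `x : Fin N → ℝ³`, `N ≥ 1` — the
  tree's `N·e⋆ ≤ E_LJ` (`ChargedEnergyGapNegative.card_mul_eStar_le`, item 0714) applied to TWO far translated copies of `x`
  (`ChargedEnergyGapNegative.copiesFin`), whose cross interactions are STRICTLY negative; double-sum form `two_mul_card_mul_eStar_lt_sum_sum`.
* **Re-rooted hard-core configurations** (§2): total mass / finite sums of `count|S`, and the two shell bounds
  `Σ_{z ∈ S} V_LJ(‖z − y‖)^± ≤ (250/12)·δ⁻¹², (250/6)·δ⁻⁶` at the RE-ROOTED configuration `θ_y(count|S) = (count|S).map (· − y)`, `y ∈ S`.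
* **The truncated identity kernel** (`exists_kernel_eq_count_restrict`): an s-finite kernel on `Measure ℝ³` equal to the identity on the
  counting measures of all `δ`-separated sets, with the joint measurability of re-rooting `(ν, y) ↦ θ_y(κ ν)` and of
  `(ν, y) ↦ ∫ f(z − y) d(κ ν)(z)` (method of the support files of item 9229, `PalmUnimodularRigidityUnimodularEnergyLowerBound*`, not
  importable on the farm at the time of writing; their elementary separated-set lemmas are re-derived as private helpers).  All `[folklore]`.
-/

noncomputable section

namespace Summit.AtomisticToContinuum.Crystallization.Theorems.FrustratedLawDichotomyFiniteClusterGap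

open MeasureTheory Metric Set Filter ProbabilityTheory
open scoped ENNReal Topology BigOperators
open Literature.MathematicalPhysics.StatisticalMechanics Literature.Probability.Process
open Summit.AtomisticToContinuum.Crystallization.Theorems.ChargedEnergyGapNegative (E3 eStar card_mul_eStar_le Dsum
  Dsum_nonneg copies copiesFin copiesFin_apply copiesFin_injective dist_copies_same le_dist_copies_ne)

/-! ## §1. Strict periodisation: `N·e⋆ < E_LJ(x)` -/

section Strict

variable {N : ℕ}

/-- **Two far copies are strictly cheaper per particle.**  For `N ≥ 1` and two copies of `x` at spacing `L` with
`L − 2D > 1` (all cross distances `> 1`, where `V_LJ < 0`): `E_LJ(two copies) < 2·E_LJ(x)`. [folklore] -/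
theorem interactionEnergy_copiesFin_two_lt (hN : 0 < N) (x : Fin N → E3) {L : ℝ} (hL : 1 < L - 2 * Dsum x) :
    interactionEnergy lennardJones (copiesFin 2 L x) < 2 * interactionEnergy lennardJones x := by
  have hL0 : 0 ≤ L := by linarith [Dsum_nonneg x]
  haveI : Nonempty (Fin N) := ⟨⟨0, hN⟩⟩
  have h2 := two_mul_interactionEnergy_eq_sum_sum lennardJones lennardJones_zero (copiesFin 2 L x)
  have h2y := two_mul_interactionEnergy_eq_sum_sum lennardJones lennardJones_zero x
  -- re-index the double sum by `Fin 2 × Fin N`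
  have hre : ∑ a, ∑ b, lennardJones (dist (copiesFin 2 L x a) (copiesFin 2 L x b)) =
      ∑ p : Fin 2 × Fin N, ∑ q : Fin 2 × Fin N, lennardJones (dist (copies 2 L x p) (copies 2 L x q)) := by
    simp only [copiesFin_apply]
    exact (finProdFinEquiv.symm.sum_comp (fun p => ∑ b : Fin (2 * N),
      lennardJones (dist (copies 2 L x p) (copies 2 L x (finProdFinEquiv.symm b))))).trans
      (Finset.sum_congr rfl fun p _ => finProdFinEquiv.symm.sum_comp
        (fun q => lennardJones (dist (copies 2 L x p) (copies 2 L x q))))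
  -- each row: the own copy gives the `x`-row, the other copy contributes a STRICTLY negative amount
  have hrow : ∀ (c : Fin 2) (i : Fin N),
      ∑ q : Fin 2 × Fin N, lennardJones (dist (copies 2 L x (c, i)) (copies 2 L x q)) <
        ∑ j, lennardJones (dist (x i) (x j)) := by
    intro c i
    rw [Fintype.sum_prod_type, ← Finset.add_sum_erase _ _ (Finset.mem_univ c)]
    have hown : ∑ j : Fin N, lennardJones (dist (copies 2 L x (c, i)) (copies 2 L x (c, j))) =
        ∑ j, lennardJones (dist (x i) (x j)) := by
      simp only [dist_copies_same]
    have hne' : (Finset.univ.erase c).Nonempty := by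
      refine ⟨c + 1, Finset.mem_erase.2 ⟨?_, Finset.mem_univ _⟩⟩
      intro h
      have h' : (c + 1 : Fin 2) - c = c - c := by rw [h]
      simp at h'
    have hrest : ∑ c' ∈ Finset.univ.erase c, ∑ j : Fin N,
        lennardJones (dist (copies 2 L x (c, i)) (copies 2 L x (c', j))) < 0 := by
      refine Finset.sum_neg (fun c' hc' => Finset.sum_neg (fun j _ => ?_) Finset.univ_nonempty) hne'
      have hne : ((c, i) : Fin 2 × Fin N).1 ≠ ((c', j) : Fin 2 × Fin N).1 :=
        fun h => (Finset.ne_of_mem_erase hc') h.symm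
      exact lennardJones_neg (hL.trans_le (le_dist_copies_ne 2 hL0 x hne))
    linarith
  have hsum : ∑ p : Fin 2 × Fin N, ∑ q : Fin 2 × Fin N, lennardJones (dist (copies 2 L x p) (copies 2 L x q)) <
      (2 : ℝ) * ∑ i, ∑ j, lennardJones (dist (x i) (x j)) := by
    rw [Fintype.sum_prod_type]
    calc ∑ c : Fin 2, ∑ i : Fin N, ∑ q : Fin 2 × Fin N, lennardJones (dist (copies 2 L x (c, i)) (copies 2 L x q))
        < ∑ _c : Fin 2, ∑ i : Fin N, ∑ j, lennardJones (dist (x i) (x j)) :=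
          Finset.sum_lt_sum_of_nonempty Finset.univ_nonempty fun c _ =>
            Finset.sum_lt_sum_of_nonempty Finset.univ_nonempty fun i _ => hrow c i
      _ = (2 : ℝ) * ∑ i, ∑ j, lennardJones (dist (x i) (x j)) := by
          rw [Finset.sum_const, Finset.card_univ, Fintype.card_fin, nsmul_eq_mul]; norm_num
  have hfin : 2 * interactionEnergy lennardJones (copiesFin 2 L x) < 2 * (2 * interactionEnergy lennardJones x) := by
    rw [h2, h2y, hre]; exact hsum
  linarith

/-- **Strict periodisation: `N·e⋆ < E_LJ(x)`** for every injective configuration of `N ≥ 1` points of `ℝ³` — no finite cluster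
is a bulk minimiser (`(2N)·e⋆ ≤ E_LJ(two far copies) < 2·E_LJ(x)`). [folklore] -/
theorem card_mul_eStar_lt_interactionEnergy (hN : 0 < N) {x : Fin N → E3} (hx : Function.Injective x) :
    (N : ℝ) * eStar < interactionEnergy lennardJones x := by
  have hL1 : 1 < (2 * Dsum x + 2) - 2 * Dsum x := by linarith
  have hL2 : 2 * Dsum x < 2 * Dsum x + 2 := by linarith
  have h1 := card_mul_eStar_le (copiesFin_injective 2 hL2 hx)
  have h2 := interactionEnergy_copiesFin_two_lt hN x hL1
  push_cast at h1
  linarith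

/-- **Strict cluster inequality, double-sum form**: for every non-empty finite `T ⊂ ℝ³`,
`2·#T·e⋆ < Σ_{y,z ∈ T} V_LJ(‖z − y‖)` (ordered pairs; diagonal terms vanish, `V_LJ(0) = 0`). [folklore] -/
theorem two_mul_card_mul_eStar_lt_sum_sum (T : Finset E3) (hT : T.Nonempty) :
    2 * (T.card : ℝ) * eStar < ∑ y ∈ T, ∑ z ∈ T, lennardJones ‖z - y‖ := by
  classical
  set e : {z // z ∈ T} ≃ Fin T.card := T.equivFin with he
  set x : Fin T.card → E3 := fun i => (e.symm i : E3) with hx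
  have hxinj : Function.Injective x := fun i j h => e.symm.injective (Subtype.ext h)
  have h1 := card_mul_eStar_lt_interactionEnergy (Finset.card_pos.2 hT) hxinj
  have h2 := two_mul_interactionEnergy_eq_sum_sum lennardJones lennardJones_zero x
  have h3 : ∑ i, ∑ k, lennardJones (dist (x i) (x k)) = ∑ y ∈ T, ∑ z ∈ T, lennardJones ‖z - y‖ := by
    have inner : ∀ y : E3, ∑ k, lennardJones (dist y (x k)) = ∑ z ∈ T, lennardJones ‖z - y‖ := by
      intro y
      rw [← Finset.sum_coe_sort T (fun z => lennardJones ‖z - y‖), ← Equiv.sum_comp e.symm]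
      refine Finset.sum_congr rfl fun k _ => ?_
      rw [dist_comm, dist_eq_norm]
    simp_rw [inner]
    rw [← Finset.sum_coe_sort T (fun y => ∑ z ∈ T, lennardJones ‖z - y‖), ← Equiv.sum_comp e.symm]
  linarith [h1, h2, h3]

end Strict

/-! ## §2. Re-rooted hard-core configurations: counting measures and Lennard-Jones shell sums -/

section Separated

variable {δ : ℝ} {S : Set E3}

/-- Packing: finitely many points of a `δ`-separated set in a closed ball, at most `(2r/δ + 1)³`. [folklore] -/
private theorem card_le_of_subset_closedBall' (hδ : 0 < δ) (hsep : ∀ x ∈ S, ∀ y ∈ S, x ≠ y → δ ≤ dist x y) {p : E3} {r : ℝ}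
    (hr : 0 ≤ r) (T : Finset E3) (hT : (↑T : Set E3) ⊆ S ∩ closedBall p r) : (T.card : ℝ) ≤ (2 * r / δ + 1) ^ 3 := by
  have h := card_le_of_separated_of_dist_le T p hδ hr (fun c hc => mem_closedBall.1 (hT hc).2)
    (fun c hc d hd hcd => hsep c (hT hc).1 d (hT hd).1 hcd)
  simpa [finrank_euclideanSpace_fin] using h

/-- A `δ`-separated set meets every closed ball in a finite set. [folklore] -/
private theorem finite_inter_closedBall' (hδ : 0 < δ) (hsep : ∀ x ∈ S, ∀ y ∈ S, x ≠ y → δ ≤ dist x y) (p : E3) (r : ℝ) :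
    (S ∩ closedBall p r).Finite := by
  by_contra hinf
  rcases lt_or_ge r 0 with hr | hr
  · rw [closedBall_eq_empty.2 hr, inter_empty] at hinf
    exact hinf finite_empty
  obtain ⟨T, hT, hcard⟩ := (show (S ∩ closedBall p r).Infinite from hinf).exists_subset_card_eq (⌈(2 * r / δ + 1) ^ 3⌉₊ + 1)
  have h1 := card_le_of_subset_closedBall' hδ hsep hr T hT
  have h2 : ((2 * r / δ + 1) ^ 3 : ℝ) < T.card := by
    rw [hcard]; push_cast; exact (Nat.le_ceil _).trans_lt (lt_add_one _)
  linarith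

/-- A `δ`-separated set (`δ > 0`) is countable. [folklore] -/
private theorem countable_of_sep (hδ : 0 < δ) (hsep : ∀ x ∈ S, ∀ y ∈ S, x ≠ y → δ ≤ dist x y) : S.Countable := by
  have : S = ⋃ n : ℕ, S ∩ closedBall 0 n := by
    ext x
    simp only [mem_iUnion, mem_inter_iff, mem_closedBall, dist_zero_right]
    exact ⟨fun hx => ⟨⌈‖x‖⌉₊, hx, Nat.le_ceil _⟩, fun ⟨n, hx, _⟩ => hx⟩
  rw [this]; exact countable_iUnion fun n => (finite_inter_closedBall' hδ hsep 0 n).countable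

/-- `count|S`-almost every point lies in `S`, for the counting measure of a `δ`-separated `S`. [folklore] -/
theorem ae_mem_of_sep (hδ : 0 < δ) (hsep : ∀ x ∈ S, ∀ y ∈ S, x ≠ y → δ ≤ dist x y) :
    ∀ᵐ y ∂((Measure.count : Measure E3).restrict S), y ∈ S := by
  rw [ae_iff, Measure.restrict_apply' (countable_of_sep hδ hsep).measurableSet, Measure.count_eq_zero_iff]
  ext x
  simp

/-- The total mass of `count|S` is `#S` for finite `S`. [folklore] -/
theorem count_restrict_univ_of_finite (hS : S.Finite) :
    (Measure.count : Measure E3).restrict S univ = (hS.toFinset.card : ℝ≥0∞) := by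
  rw [Measure.restrict_apply MeasurableSet.univ, univ_inter, Measure.count_apply_finite S hS]

/-- The total mass of `count|S` is `∞` for infinite `S`. [folklore] -/
theorem count_restrict_univ_of_infinite (hS : S.Infinite) :
    (Measure.count : Measure E3).restrict S univ = ∞ := by
  rw [Measure.restrict_apply MeasurableSet.univ, univ_inter, Measure.count_apply_infinite hS]

/-- Integration against `count|S`, `S` finite, is a finite sum. [folklore] -/
theorem lintegral_count_restrict_of_finite (hS : S.Finite) (f : E3 → ℝ≥0∞) :
    ∫⁻ y, f y ∂((Measure.count : Measure E3).restrict S) = ∑ y ∈ hS.toFinset, f y := by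
  conv_lhs => rw [← hS.coe_toFinset]
  rw [lintegral_finset]
  simp only [Measure.count_singleton, mul_one]

/-- The atoms of `count|S` are the points of `S`. [folklore] -/
theorem setOf_count_restrict_singleton_ne_zero (S : Set E3) :
    {p : E3 | (Measure.count : Measure E3).restrict S {p} ≠ 0} = S := by
  ext p; exact count_restrict_singleton_ne_zero_iff S p

/-- Re-rooting does not change the total mass. [folklore] -/
theorem map_sub_univ (μ : Measure E3) (y : E3) : (μ.map fun z => z - y) univ = μ univ := by
  rw [Measure.map_apply (measurable_sub_const y) MeasurableSet.univ, preimage_univ]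

/-- `V_LJ` is measurable. [folklore] -/
private theorem measurable_lennardJones' : Measurable lennardJones := by
  unfold lennardJones; fun_prop

/-- The two `ℝ≥0∞`-valued parts `z ↦ V_LJ(‖z‖)^±` of the Lennard-Jones field of the root are measurable. [folklore] -/
theorem measurable_ofReal_lennardJones_parts :
    Measurable (fun z : E3 => ENNReal.ofReal (lennardJones ‖z‖)) ∧
      Measurable (fun z : E3 => ENNReal.ofReal (-lennardJones ‖z‖)) :=
  ⟨ENNReal.measurable_ofReal.comp (measurable_lennardJones'.comp measurable_norm),
    ENNReal.measurable_ofReal.comp ((measurable_lennardJones'.comp measurable_norm).neg)⟩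

/-- Shell bound, finite form: `Σ_{z ∈ T, z ≠ y} (dist y z)⁻⁶ ≤ 250 δ⁻⁶` for a finite `δ`-separated `T ∋ y`. [folklore] -/
private theorem sum_erase_inv_pow_six_le' (hδ : 0 < δ) (T : Finset E3) (hsep : ∀ x ∈ T, ∀ z ∈ T, x ≠ z → δ ≤ dist x z)
    {y : E3} (hy : y ∈ T) : ∑ z ∈ T.erase y, (dist y z)⁻¹ ^ 6 ≤ 250 * δ⁻¹ ^ 6 := by
  classical
  set e : {z // z ∈ T} ≃ Fin T.card := T.equivFin with he
  set x : Fin T.card → E3 := fun i => (e.symm i : E3) with hx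
  have hxsep : ∀ k l, k ≠ l → δ ≤ dist (x k) (x l) := fun k l hkl =>
    hsep _ (e.symm k).2 _ (e.symm l).2 fun h => hkl (e.symm.injective (Subtype.ext h))
  have h := sum_inv_pow_six_le x hδ hxsep (e ⟨y, hy⟩)
  have hxy : x (e ⟨y, hy⟩) = y := by simp [hx]
  rw [hxy] at h; refine le_trans (le_of_eq ?_) h
  refine Finset.sum_bij' (fun z hz => e ⟨z, (Finset.mem_erase.1 hz).2⟩) (fun k _ => (e.symm k : E3)) ?_ ?_ ?_ ?_ ?_
  · intro z hz
    refine Finset.mem_erase.2 ⟨fun h' => (Finset.mem_erase.1 hz).1 ?_, Finset.mem_univ _⟩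
    have := congrArg (fun i => (e.symm i : E3)) h'
    simpa using this
  · intro k hk
    refine Finset.mem_erase.2 ⟨fun h' => (Finset.mem_erase.1 hk).1 ?_, (e.symm k).2⟩
    have : e.symm k = ⟨y, hy⟩ := Subtype.ext h'
    rw [← this, Equiv.apply_symm_apply]
  · intro z hz; simp
  · intro k hk; simp
  · intro z hz; simp [hx]

/-- Both parts of `V_LJ` from a point `y` of a finite `δ`-separated `T`, summed over `T ∖ {y}`:
`Σ (V_LJ)⁺ ≤ (250/12)·δ⁻¹²` and `Σ (V_LJ)⁻ ≤ (250/6)·δ⁻⁶`. [folklore] -/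
private theorem sum_erase_lennardJones_parts_le (hδ : 0 < δ) (T : Finset E3) (hsep : ∀ x ∈ T, ∀ z ∈ T, x ≠ z → δ ≤ dist x z)
    {y : E3} (hy : y ∈ T) :
    ∑ z ∈ T.erase y, ENNReal.ofReal (lennardJones ‖z - y‖) ≤ ENNReal.ofReal (250 / 12 * δ⁻¹ ^ 12) ∧
      ∑ z ∈ T.erase y, ENNReal.ofReal (-lennardJones ‖z - y‖) ≤ ENNReal.ofReal (250 / 6 * δ⁻¹ ^ 6) := by
  have hs := sum_erase_inv_pow_six_le' hδ T hsep hy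
  constructor
  · calc ∑ z ∈ T.erase y, ENNReal.ofReal (lennardJones ‖z - y‖)
        ≤ ∑ z ∈ T.erase y, ENNReal.ofReal ((1 / 12) * δ⁻¹ ^ 6 * (dist y z)⁻¹ ^ 6) :=
          Finset.sum_le_sum fun z hz => by
            rw [← dist_eq_norm, dist_comm]
            have hr := hsep y hy z (Finset.mem_of_mem_erase hz) (Finset.ne_of_mem_erase hz).symm
            apply ENNReal.ofReal_le_ofReal
            have hr0 : 0 < dist y z := hδ.trans_le hr
            have h1 : (dist y z)⁻¹ ≤ δ⁻¹ := by rw [inv_le_inv₀ hr0 hδ]; exact hr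
            have h2 : 0 ≤ (dist y z)⁻¹ := inv_nonneg.2 hr0.le
            have h3 : (dist y z)⁻¹ ^ 6 ≤ δ⁻¹ ^ 6 := pow_le_pow_left₀ h2 h1 6
            have h4 : 0 ≤ (dist y z)⁻¹ ^ 6 := pow_nonneg h2 6
            have h5 : (dist y z)⁻¹ ^ 12 = (dist y z)⁻¹ ^ 6 * (dist y z)⁻¹ ^ 6 := by ring
            unfold lennardJones
            rw [h5]
            nlinarith [mul_le_mul_of_nonneg_right h3 h4]
      _ = ENNReal.ofReal (∑ z ∈ T.erase y, (1 / 12) * δ⁻¹ ^ 6 * (dist y z)⁻¹ ^ 6) :=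
          (ENNReal.ofReal_sum_of_nonneg fun z _ => by positivity).symm
      _ ≤ ENNReal.ofReal (250 / 12 * δ⁻¹ ^ 12) := by
          apply ENNReal.ofReal_le_ofReal
          rw [← Finset.mul_sum]
          have h6 : (0 : ℝ) ≤ δ⁻¹ ^ 6 := by positivity
          have h12 : δ⁻¹ ^ 12 = δ⁻¹ ^ 6 * δ⁻¹ ^ 6 := by ring
          rw [h12]
          nlinarith [mul_le_mul_of_nonneg_left hs h6]
  · calc ∑ z ∈ T.erase y, ENNReal.ofReal (-lennardJones ‖z - y‖)
        ≤ ∑ z ∈ T.erase y, ENNReal.ofReal ((1 / 6) * (dist y z)⁻¹ ^ 6) :=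
          Finset.sum_le_sum fun z _ => by
            rw [← dist_eq_norm, dist_comm]
            generalize dist y z = r
            apply ENNReal.ofReal_le_ofReal
            have : 0 ≤ (1 / 12) * (r⁻¹) ^ 12 := by positivity
            unfold lennardJones
            linarith
      _ = ENNReal.ofReal (∑ z ∈ T.erase y, (1 / 6) * (dist y z)⁻¹ ^ 6) :=
          (ENNReal.ofReal_sum_of_nonneg fun z _ => by positivity).symm
      _ ≤ ENNReal.ofReal (250 / 6 * δ⁻¹ ^ 6) := by
          apply ENNReal.ofReal_le_ofReal
          rw [← Finset.mul_sum]
          nlinarith [hs]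

/-- **Shell bounds at a re-rooted configuration.**  For a `δ`-separated `S` and `y ∈ S`, the configuration re-rooted at `y`,
`θ_y(count|S) = (count|S).map (· − y)`, has `∫ V_LJ(‖z‖)⁺ ≤ (250/12)·δ⁻¹²` and `∫ V_LJ(‖z‖)⁻ ≤ (250/6)·δ⁻⁶`. [folklore] -/
theorem lintegral_lennardJones_parts_map_sub_le (hδ : 0 < δ) (hsep : ∀ x ∈ S, ∀ y ∈ S, x ≠ y → δ ≤ dist x y) {y : E3}
    (hy : y ∈ S) :
    ∫⁻ z, ENNReal.ofReal (lennardJones ‖z‖) ∂(((Measure.count : Measure E3).restrict S).map fun z => z - y) ≤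
        ENNReal.ofReal (250 / 12 * δ⁻¹ ^ 12) ∧
      ∫⁻ z, ENNReal.ofReal (-lennardJones ‖z‖) ∂(((Measure.count : Measure E3).restrict S).map fun z => z - y) ≤
        ENNReal.ofReal (250 / 6 * δ⁻¹ ^ 6) := by
  classical
  have hS := countable_of_sep hδ hsep
  haveI := hS.to_subtype
  -- both parts as suprema of finite sums over `S`
  have key : ∀ (g : E3 → ℝ≥0∞) (C : ℝ≥0∞), Measurable g →
      (∀ T : Finset E3, (∀ z ∈ T, z ∈ S) → y ∈ T → ∑ z ∈ T.erase y, g (z - y) ≤ C) → g 0 = 0 →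
      ∫⁻ z, g z ∂(((Measure.count : Measure E3).restrict S).map fun z => z - y) ≤ C := by
    intro g C hg hT hg0
    rw [lintegral_map hg (measurable_sub_const y), lintegral_countable _ hS, ENNReal.tsum_eq_iSup_sum]
    refine iSup_le fun T' => ?_
    set T : Finset E3 := insert y (T'.map (Function.Embedding.subtype (· ∈ S))) with hTdef
    have hTS : ∀ z ∈ T, z ∈ S := by
      intro z hz
      rcases Finset.mem_insert.1 hz with rfl | hz
      · exact hy
      · obtain ⟨w, -, rfl⟩ := Finset.mem_map.1 hz
        exact w.2
    have hyT : y ∈ T := Finset.mem_insert_self _ _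
    calc ∑ z ∈ T', g ((z : E3) - y) * (Measure.count : Measure E3) {(z : E3)}
        = ∑ z ∈ T', g ((z : E3) - y) := Finset.sum_congr rfl fun z _ => by
          rw [Measure.count_singleton, mul_one]
      _ = ∑ z ∈ T'.map (Function.Embedding.subtype (· ∈ S)), g (z - y) := by rw [Finset.sum_map]; rfl
      _ ≤ ∑ z ∈ T, g (z - y) := Finset.sum_le_sum_of_subset (Finset.subset_insert _ _)
      _ = ∑ z ∈ T.erase y, g (z - y) := by rw [← Finset.add_sum_erase T _ hyT, sub_self, hg0, zero_add]
      _ ≤ C := hT T hTS hyT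
  obtain ⟨hp, hm⟩ := measurable_ofReal_lennardJones_parts
  refine ⟨key _ _ hp (fun T hTS hyT => ?_) (by simp [lennardJones_zero]),
    key _ _ hm (fun T hTS hyT => ?_) (by simp [lennardJones_zero])⟩
  · exact (sum_erase_lennardJones_parts_le hδ T (fun x hx z hz hxz => hsep x (hTS x hx) z (hTS z hz) hxz) hyT).1
  · exact (sum_erase_lennardJones_parts_le hδ T (fun x hx z hz hxz => hsep x (hTS x hx) z (hTS z hz) hxz) hyT).2

end Separated

/-! ## §3. The truncated identity kernel and joint measurability of re-rooting -/

section Kernel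

variable {δ : ℝ}

/-- **The truncated identity kernel.** For `δ > 0` there is an s-finite kernel `κ` on `Measure ℝ³` with `κ (count|S) = count|S` for
every `δ`-separated `S` (cut `ℝ³` into the shells `⌊‖z‖⌋ = n`; on each shell keep `μ` if its mass there is at most the packing bound,
else `0`; sum over `n`). [folklore] -/
theorem exists_kernel_eq_count_restrict (hδ : 0 < δ) :
    ∃ κ : Kernel (Measure E3) E3, IsSFiniteKernel κ ∧ ∀ S : Set E3, (∀ x ∈ S, ∀ y ∈ S, x ≠ y → δ ≤ dist x y) →
      κ ((Measure.count : Measure E3).restrict S) = (Measure.count : Measure E3).restrict S := by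
  classical
  let A : ℕ → Set E3 := fun n => (fun z : E3 => ⌊‖z‖⌋₊) ⁻¹' {n}
  have hAm : ∀ n, MeasurableSet (A n) := fun n => (Nat.measurable_floor.comp measurable_norm) (measurableSet_singleton n)
  have hAdisj : Pairwise (Function.onFun Disjoint A) := fun i j hij =>
    Set.disjoint_iff.2 fun z hz => hij (hz.1.symm.trans hz.2)
  have hAcov : (⋃ n, A n) = univ := iUnion_eq_univ_iff.2 fun z => ⟨_, rfl⟩
  have hAball : ∀ n, A n ⊆ closedBall 0 ((n : ℝ) + 1) := fun n z hz => by
    have hz' : ⌊‖z‖⌋₊ = n := hz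
    rw [mem_closedBall, dist_zero_right, ← hz']
    exact (Nat.lt_floor_add_one ‖z‖).le
  let M : ℕ → ℝ≥0∞ := fun n => ENNReal.ofReal ((2 * ((n : ℝ) + 1) / δ + 1) ^ 3)
  let κs : ℕ → Kernel (Measure E3) E3 := fun n =>
    { toFun := fun μ => if μ (A n) ≤ M n then μ.restrict (A n) else 0
      measurable' := by
        refine Measure.measurable_of_measurable_coe _ fun s hs => ?_
        have : (fun μ : Measure E3 => (if μ (A n) ≤ M n then μ.restrict (A n) else 0) s) =
            fun μ => if μ (A n) ≤ M n then μ (s ∩ A n) else 0 := by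
          funext μ
          split_ifs <;> simp [Measure.restrict_apply hs]
        rw [this]
        exact Measurable.ite ((Measure.measurable_coe (hAm n)) measurableSet_Iic)
          (Measure.measurable_coe (hs.inter (hAm n))) measurable_const }
  have hκs_apply : ∀ n (μ : Measure E3), κs n μ = if μ (A n) ≤ M n then μ.restrict (A n) else 0 := fun n μ => rfl
  have hfin : ∀ n, IsFiniteKernel (κs n) := fun n => by
    refine ⟨⟨M n, ENNReal.ofReal_lt_top, fun μ => ?_⟩⟩
    rw [hκs_apply]
    split_ifs with h
    · rw [Measure.restrict_apply_univ]; exact h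
    · simp
  refine ⟨Kernel.sum κs, inferInstance, fun S hsep => ?_⟩
  have hle : ∀ n, (Measure.count : Measure E3).restrict S (A n) ≤ M n := fun n => by
    refine (measure_mono (hAball n)).trans ?_
    have hfin' : (closedBall (0 : E3) ((n : ℝ) + 1) ∩ S).Finite := by
      rw [inter_comm]; exact finite_inter_closedBall' hδ hsep 0 _
    rw [Measure.restrict_apply measurableSet_closedBall, Measure.count_apply_finite _ hfin', ← ENNReal.ofReal_natCast]
    refine ENNReal.ofReal_le_ofReal (card_le_of_subset_closedBall' (p := 0) hδ hsep (by positivity) _ ?_)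
    rw [Finite.coe_toFinset, inter_comm]
  rw [Kernel.sum_apply]
  have : (fun n => κs n ((Measure.count : Measure E3).restrict S)) =
      fun n => ((Measure.count : Measure E3).restrict S).restrict (A n) := by
    funext n
    rw [hκs_apply, if_pos (hle n)]
  rw [this, ← Measure.restrict_iUnion hAdisj hAm, hAcov, Measure.restrict_univ]

variable (κ : Kernel (Measure E3) E3) [IsSFiniteKernel κ]

/-- For an s-finite kernel `κ`, re-rooting `(ν, y) ↦ θ_y (κ ν) = (κ ν).map (· − y)` is jointly measurable. [folklore] -/
theorem measurable_kernel_map_sub : Measurable fun q : Measure E3 × E3 => (κ q.1).map fun z => z - q.2 := by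
  refine Measure.measurable_of_measurable_coe _ fun s hs => ?_
  have ht : MeasurableSet {r : (Measure E3 × E3) × E3 | r.2 - r.1.2 ∈ s} :=
    (measurable_snd.sub measurable_fst.snd) hs
  have h := Kernel.measurable_kernel_prodMk_left (κ := Kernel.prodMkRight E3 κ) ht
  have heq : (fun q : Measure E3 × E3 => ((κ q.1).map fun z => z - q.2) s) =
      fun q => Kernel.prodMkRight E3 κ q (Prod.mk q ⁻¹' {r : (Measure E3 × E3) × E3 | r.2 - r.1.2 ∈ s}) := by
    funext q
    rw [Measure.map_apply (measurable_sub_const q.2) hs, Kernel.prodMkRight_apply]; rfl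
  rw [heq]; exact h

/-- For an s-finite kernel `κ` and measurable `f ≥ 0`, `(ν, y) ↦ ∫⁻ f(z − y) d(κ ν)(z)` is jointly measurable. [folklore] -/
theorem measurable_lintegral_kernel_sub {f : E3 → ℝ≥0∞} (hf : Measurable f) :
    Measurable fun q : Measure E3 × E3 => ∫⁻ z, f (z - q.2) ∂(κ q.1) := by
  have hg : Measurable (Function.uncurry fun (q : Measure E3 × E3) (z : E3) => f (z - q.2)) :=
    hf.comp (measurable_snd.sub measurable_fst.snd)
  have h := Measurable.lintegral_kernel_prod_right (κ := Kernel.prodMkRight E3 κ) hg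
  have heq : (fun q : Measure E3 × E3 => ∫⁻ z, f (z - q.2) ∂(κ q.1)) =
      fun q => ∫⁻ z, f (z - q.2) ∂(Kernel.prodMkRight E3 κ q) := by
    funext q; rw [Kernel.prodMkRight_apply]
  rw [heq]; exact h

end Kernel

end Summit.AtomisticToContinuum.Crystallization.Theorems.FrustratedLawDichotomyFiniteClusterGap

end
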